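import Summits.Ventures.Crystal3D.Theorems.StickyWulffConstantGenericWallFloorCapStartBarlow
import HarnessLib

/-!
# A moved Barlow plate lies in ONE reach set: `L·B(σ) + s₀ ⊆ reachSet L t₀ M` whenever `L, twinFrame L (L e₃) ∈ M`
# (crux `GenericWallFloor`, stmt-Ventures-19480, line `WallLedgerG`; off-registry instantiation of the walker ledger for lane T)

HONEST FRAMING. Venture `Summits/Ventures/Crystal3D` (cell `crystal3d-full`), helper `--supports` the crux `GenericWallFloor`
(stmt-Ventures-19480) of `route-Ventures-StickyWulffConstant`, registered line `WallLedgerG`, open stub `stub_twoSlabAdhesion`.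
Rung credit only; F-C1 not moved; NOT the stub.

The positional non-arrival of `…WalkReach` / `…StackLedgerOffReach` needs the START positions of a plate's walker family in one
reach set `reachSet A t M = A·Λ₀ + t + reachGroup M` (then every walk position stays there, `walkRun_fst_mem_reachSet`, and two
plates with disjoint reach sets have positionally disjoint ends — hypothesis `hdisj` of `walkerFamilies_card_le_payers`).
For a moved BARLOW stacking `p ↦ L·barlowPos σ k i j + s₀` (per-top frames `L` / `twinFrame L (L e₃)`, `…CapStartBarlow`):

* `barlowPos_succ_eq_add` — consecutive layers differ by `σ k · w + √(2/3) e₃`;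
* `upSlot_mem_fccSlots`, `step_eq_frame_slot` — that step is the model upper slot `barlowPos const 1 0 0` moved by `L` (`σ k = 1`)
  or the slot `−(barlowPos const 1 0 0)` moved by the twin frame `twinFrame L (L e₃)` (`σ k = −1`), hence in `reachGroup M`;
* **`barlow_mem_reachSet`** — every site `L·barlowPos σ k i j + s₀` lies in `reachSet L (L (haggLabel σ 0 · w) + s₀) M` for any
  frame set `M` containing `L` and `twinFrame L (L e₃)` (induction over the layer index, both directions).

WHAT THIS IS NOT: not the stub; no countability/registry statement for Barlow pairs (that is `…OffReachCountable`'s business once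
the frame sets are fixed); F-C1 not moved.
-/

noncomputable section

namespace Summit.Ventures.Crystal3D.Theorems

open Finset
open Literature.MathematicalPhysics.StatisticalMechanics
open scoped InnerProductSpace

/-- **Consecutive layers of a Barlow stacking** differ by `σ k · w + layerNormal`: `barlowPos σ (k+1) i j =
barlowPos σ k i j + (σ k · barlowOffset + layerNormal)`. -/
theorem barlowPos_succ_eq_add (a c : ℝ) (σ : ℤ → ℤ) (k i j : ℤ) :
    barlowPos a c σ (k + 1) i j = barlowPos a c σ k i j + ((σ k : ℝ) • barlowOffset a + layerNormal c) := by
  simp only [barlowPos, haggLabel_succ]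
  push_cast
  module

/-- The model UPPER slot `u⁺ = w + √(2/3) e₃ = barlowPos const 1 0 0` is a slot. -/
theorem upSlot_mem_fccSlots : barlowPos 1 (Real.sqrt (2 / 3)) constHagg 1 0 0 ∈ fccSlots := by
  classical
  rw [fccSlots, Finset.mem_image]
  exact ⟨(1, 0, 0), by simp [fccSlotTriples], rfl⟩

/-- The model upper slot in coordinates: `barlowPos const 1 0 0 = w + layerNormal`. -/
theorem upSlot_eq : barlowPos 1 (Real.sqrt (2 / 3)) constHagg 1 0 0 = barlowOffset 1 + layerNormal (Real.sqrt (2 / 3)) := by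
  simp only [barlowPos, haggLabel_const]
  push_cast
  module

/-- The basal mirror of the upper slot: `basalMirror (w + layerNormal) = w − layerNormal` (it fixes the layer plane and flips
the axis). -/
theorem basalMirror_upSlot :
    basalMirror (barlowOffset 1 + layerNormal (Real.sqrt (2 / 3))) = barlowOffset 1 - layerNormal (Real.sqrt (2 / 3)) := by
  ext t
  rw [basalMirror_apply_coord]
  fin_cases t <;> simp [barlowOffset, layerNormal]

/-- **The layer step is a frame slot.**  `σ k = 1`: the step `σ k · w + layerNormal` is `L⁻¹`-free, it is the model upper slot,
so after the motion it is `L u⁺`; `σ k = −1`: it is `−w + layerNormal = basalMirror (−u⁺)`, after the motion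
`twinFrame L (L e₃) (−u⁺)`. -/
theorem step_eq_frame_slot (L : EuclideanSpace ℝ (Fin 3) ≃ₗᵢ[ℝ] EuclideanSpace ℝ (Fin 3)) {σ : ℤ → ℤ} (hσ : IsHaggSeq σ)
    (k : ℤ) :
    L ((σ k : ℝ) • barlowOffset 1 + layerNormal (Real.sqrt (2 / 3))) = L (barlowPos 1 (Real.sqrt (2 / 3)) constHagg 1 0 0) ∨
    L ((σ k : ℝ) • barlowOffset 1 + layerNormal (Real.sqrt (2 / 3))) =
      twinFrame L (L (EuclideanSpace.single (2 : Fin 3) (1 : ℝ))) (-barlowPos 1 (Real.sqrt (2 / 3)) constHagg 1 0 0) := by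
  rcases hσ k with hk | hk
  · left; rw [hk, upSlot_eq]; push_cast; rw [one_smul]
  · right
    rw [hk, twinFrame_axis_apply, map_neg, upSlot_eq, basalMirror_upSlot]
    congr 1
    push_cast
    module

/-- The layer step lies in the reach group of any frame set containing `L` and its twin across the moved axis. -/
theorem step_mem_reachGroup (L : EuclideanSpace ℝ (Fin 3) ≃ₗᵢ[ℝ] EuclideanSpace ℝ (Fin 3)) {σ : ℤ → ℤ} (hσ : IsHaggSeq σ)
    {M : Set (EuclideanSpace ℝ (Fin 3) ≃ₗᵢ[ℝ] EuclideanSpace ℝ (Fin 3))} (hL : L ∈ M)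
    (hG : twinFrame L (L (EuclideanSpace.single (2 : Fin 3) (1 : ℝ))) ∈ M) (k : ℤ) :
    L ((σ k : ℝ) • barlowOffset 1 + layerNormal (Real.sqrt (2 / 3))) ∈ reachGroup M := by
  rcases step_eq_frame_slot L hσ k with h | h
  · rw [h]; exact frame_slot_mem_reachGroup hL upSlot_mem_fccSlots
  · rw [h]; exact frame_slot_mem_reachGroup hG (neg_mem_fccSlots upSlot_mem_fccSlots)

/-- **A moved Barlow plate lies in one reach set.**  For a Hägg sequence `σ`, a rigid motion `p ↦ L p + s₀` and any frame set
`M ∋ L, twinFrame L (L e₃)`: every site `L·barlowPos σ k i j + s₀` lies in `reachSet L (L (haggLabel σ 0 · w) + s₀) M`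
(layer `0` is the moved fcc layer `0` translated by `haggLabel σ 0 · w`; every other layer is reached by layer steps, which are
slot vectors of `L` or of its twin). -/
theorem barlow_mem_reachSet (L : EuclideanSpace ℝ (Fin 3) ≃ₗᵢ[ℝ] EuclideanSpace ℝ (Fin 3)) (s₀ : EuclideanSpace ℝ (Fin 3))
    {σ : ℤ → ℤ} (hσ : IsHaggSeq σ) {M : Set (EuclideanSpace ℝ (Fin 3) ≃ₗᵢ[ℝ] EuclideanSpace ℝ (Fin 3))} (hL : L ∈ M)
    (hG : twinFrame L (L (EuclideanSpace.single (2 : Fin 3) (1 : ℝ))) ∈ M) (k i j : ℤ) :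
    L (barlowPos 1 (Real.sqrt (2 / 3)) σ k i j) + s₀ ∈
      reachSet L (L ((haggLabel σ 0 : ℝ) • barlowOffset 1) + s₀) M := by
  -- layer `0`: a translate of the model layer `0`
  have h0 : ∀ i j : ℤ, L (barlowPos 1 (Real.sqrt (2 / 3)) σ 0 i j) + s₀ ∈
      reachSet L (L ((haggLabel σ 0 : ℝ) • barlowOffset 1) + s₀) M := by
    intro i j
    refine mem_reachSet_of_mem_lattice ⟨barlowPos 1 (Real.sqrt (2 / 3)) constHagg 0 i j, barlowPos_mem 0 i j, ?_⟩
    show L (barlowPos 1 (Real.sqrt (2 / 3)) constHagg 0 i j) + (L ((haggLabel σ 0 : ℝ) • barlowOffset 1) + s₀) =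
      L (barlowPos 1 (Real.sqrt (2 / 3)) σ 0 i j) + s₀
    rw [barlowPos_eq_translate_fcc 1 (Real.sqrt (2 / 3)) σ 0 i j, map_add]
    push_cast
    rw [sub_zero]; abel
  -- the layer step, up and down
  have hup : ∀ k : ℤ, L (barlowPos 1 (Real.sqrt (2 / 3)) σ k i j) + s₀ ∈ reachSet L (L ((haggLabel σ 0 : ℝ) • barlowOffset 1) + s₀) M →
      L (barlowPos 1 (Real.sqrt (2 / 3)) σ (k + 1) i j) + s₀ ∈ reachSet L (L ((haggLabel σ 0 : ℝ) • barlowOffset 1) + s₀) M := by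
    intro k hk
    have e : L (barlowPos 1 (Real.sqrt (2 / 3)) σ (k + 1) i j) + s₀ =
        L (barlowPos 1 (Real.sqrt (2 / 3)) σ k i j) + s₀ + L ((σ k : ℝ) • barlowOffset 1 + layerNormal (Real.sqrt (2 / 3))) := by
      rw [barlowPos_succ_eq_add, map_add]; abel
    rw [e]; exact add_mem_reachSet hk (step_mem_reachGroup L hσ hL hG k)
  have hdown : ∀ k : ℤ, L (barlowPos 1 (Real.sqrt (2 / 3)) σ (k + 1) i j) + s₀ ∈ reachSet L (L ((haggLabel σ 0 : ℝ) • barlowOffset 1) + s₀) M →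
      L (barlowPos 1 (Real.sqrt (2 / 3)) σ k i j) + s₀ ∈ reachSet L (L ((haggLabel σ 0 : ℝ) • barlowOffset 1) + s₀) M := by
    intro k hk
    have e : L (barlowPos 1 (Real.sqrt (2 / 3)) σ k i j) + s₀ =
        L (barlowPos 1 (Real.sqrt (2 / 3)) σ (k + 1) i j) + s₀ + -L ((σ k : ℝ) • barlowOffset 1 + layerNormal (Real.sqrt (2 / 3))) := by
      rw [barlowPos_succ_eq_add, map_add]; abel
    rw [e]; exact add_mem_reachSet hk ((reachGroup M).neg_mem (step_mem_reachGroup L hσ hL hG k))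
  induction k using Int.induction_on with
  | zero => exact h0 i j
  | succ k ih => exact hup k ih
  | pred k ih =>
    refine hdown (-(k : ℤ) - 1) ?_
    rw [sub_add_cancel]; exact ih

end Summit.Ventures.Crystal3D.Theorems

end
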